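import Summits.Schanuel.Schanuel.Theorems.ZilberEacBranchEqualOrderGrowth
import HarnessLib

/-!
# Arbitrary base branches, XIX: ONE GOOD DIRECTION SUFFICES — and three directions always
# contain a good one

HONEST FRAMING.  Cell `pub-schanuel` (Zilber's Exponential-Algebraic Closedness, case ladder;
host summit Schanuel), seat 2, gen 28.  File XV proved density of the exponential points of a
cylinder germ `(s^{-k}, Φ(s)s^{-M}, ψ(s), e^{x₁})` (`k, M ≥ 1`, `ψ(0) ≠ 0`) under the direction
condition `Re(Φ(0)·z^M) ≠ 0` for EVERY `k`-th root `z` of `2πi`.  The universal quantifier was an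
artefact: the ramified chart `m` of the witness construction has `m′(0)^k = 2πi`, and WHICH root
`m′(0)` is was left unspecified.  Here the chart is given a PRESCRIBED tangent
(**`exists_ramifiedChart_root`**: replace `m` by `ωm`, `ω^k = 1`), so ONE good direction suffices:
**`unprojectedDense_branch_growth_of_exists_direction`** — dense as soon as `Re(Φ(0)·z^M) ≠ 0`
for SOME `k`-th root `z` of `2πi`.  (Geometrically: the exponential points of the cylinder come in
`k` families, one per direction; density needs growth along ONE family only.)
And a good direction always exists when the directions are at least three: if `k ∤ 2M` then the
values `Φ(0)z^M` (`z^k = 2πi`) contain two of equal modulus that are not `±` each other, so not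
both purely imaginary (**`exists_direction_of_not_dvd`**).  Hence the unconditional
**`unprojectedDense_branch_of_not_dvd`**: `S ⊆ ℂ² × ℂ²` irreducible closed of dimension `≤ 2`
containing a cylinder germ `(s^{-k}, Φ(s)s^{-M}, ψ(s), e^{Φ(s)s^{-M}})` with `ψ(0) ≠ 0`,
`Φ(0) ≠ 0`, `k, M ≥ 1` and `k ∤ 2M` has `I(S ∩ Γ_exp) = I(S)` — NO condition on the direction, in
all three regimes (second coordinate slower `M < k`, e.g. `(k, M) = (3, 1), (3, 2), (5, 4)`; faster,
e.g. `(3, 4)`; never equal, since `k ∣ 2k`).  When `k ∣ 2M` (at most two directions `±`) the single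
condition `Re(Φ(0)c^M) ≠ 0` (`c` the principal root) is what remains, and it can fail together with
density (`x₁ = x₀²/(2πi)`, `y₀ = 1`: `k = 1`, `M = 2`, gen 22).  Decided instances of an OPEN
question (Mantova–Masser, PLMS 2024 §1 p. 5); EC(3,2) OPEN; NOT Schanuel's conjecture (neither used
nor implied); EAC ⇏ SC.
-/

noncomputable section

open Filter Topology Polynomial MvPolynomial Bornology Complex
open Literature.NumberTheory.Transcendental Literature.ModelTheory.Zilber
open Literature.ModelTheory.ExponentialFields

set_option linter.dupNamespace false

namespace Summit.Schanuel.Schanuel.Theorems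

/-! ## Part A. The ramified chart with a prescribed tangent -/

/-- **Ramified chart with prescribed tangent.**  For every `k`-th root `z` of `2πi` there is a chart
`m` as in `exists_ramifiedChart` (`2πi·m(s)^{-k} = s^{-k} − log(ψ(s)/θ) − τ`) with `m′(0) = z`:
multiply any chart by the `k`-th root of unity `z/m′(0)`. [folklore] -/
theorem exists_ramifiedChart_root {ψ : ℂ → ℂ} (hψ : AnalyticAt ℂ ψ 0) {θ : ℂ} (hθ0 : θ ≠ 0)
    (hψ0 : ψ 0 = θ) (τ : ℂ) {k : ℕ} (hk : 1 ≤ k) {z : ℂ} (hz : z ^ k = 2 * Real.pi * I) :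
    ∃ m : ℂ → ℂ, AnalyticAt ℂ m 0 ∧ m 0 = 0 ∧ deriv m 0 = z ∧
      ∀ᶠ s in 𝓝 (0 : ℂ), AnalyticAt ℂ ψ s ∧ ψ s ≠ 0 ∧ ψ s / θ ∈ Complex.slitPlane ∧
        ‖Complex.log (ψ s / θ)‖ < 1 ∧
        (s ≠ 0 → m s ≠ 0 ∧
          (2 * Real.pi * I) * (m s ^ k)⁻¹ = (s ^ k)⁻¹ - Complex.log (ψ s / θ) - τ) := by
  obtain ⟨m, hman, hm0, hm', hchart⟩ := exists_ramifiedChart hψ hθ0 hψ0 τ hk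
  have hmk : deriv m 0 ^ k = 2 * Real.pi * I := deriv_chart_pow_eq hψ hθ0 hψ0 hk hman hm0 hchart
  have h2πI : (2 * Real.pi * I : ℂ) ≠ 0 := by simp [Real.pi_ne_zero, Complex.I_ne_zero]
  set ω : ℂ := z / deriv m 0 with hω
  have hωk : ω ^ k = 1 := by
    rw [hω, div_pow, hz, hmk, div_self h2πI]
  have hz0 : z ≠ 0 := by
    rintro rfl
    rw [zero_pow (by omega)] at hz
    exact h2πI hz.symm
  have hω0 : ω ≠ 0 := div_ne_zero hz0 hm'
  refine ⟨fun s => ω * m s, analyticAt_const.mul hman, by simp [hm0], ?_, ?_⟩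
  · rw [deriv_const_mul _ hman.differentiableAt, hω, div_mul_cancel₀ _ hm']
  · filter_upwards [hchart] with s hs
    refine ⟨hs.1, hs.2.1, hs.2.2.1, hs.2.2.2.1, fun hs0 => ?_⟩
    obtain ⟨hms, hid⟩ := hs.2.2.2.2 hs0
    refine ⟨mul_ne_zero hω0 hms, ?_⟩
    rw [mul_pow, hωk, one_mul]
    exact hid

/-! ## Part B. One good direction suffices -/

/-- **Growth from ONE direction.**  A cylinder germ `(s^{-k}, Φ(s)s^{-M}, ψ(s), e^{x₁})`
(`k, M ≥ 1`) in an irreducible closed `S` of dimension `≤ 2`, with `ψ(0) ≠ 0` and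
`Re(Φ(0)·z^M) ≠ 0` for SOME `k`-th root `z` of `2πi`, gives Zariski-dense exponential points: run
the witness construction of file I on the chart with tangent `z` (Part A); the phase polynomial has
`Π_M = Φ(0)z^M` (file XIV) with `Re Π_M ≠ 0`, and THEOREM G applies as in file XV.
[cite: MantovaMasser2023, §1 Further remarks, p. 5 (the question, open in general)] (new) -/
theorem unprojectedDense_branch_growth_of_exists_direction {S : Set (Fin 2 ⊕ Fin 2 → ℂ)}
    (hS : IsIrreducibleClosed ℂ S) (hdim : zariskiDim ℂ S ≤ (2 : ℕ))
    {k M : ℕ} (hk : 1 ≤ k) (hM : 1 ≤ M) {ψ : ℂ → ℂ} (hψ : AnalyticAt ℂ ψ 0) {θ : ℂ} (hθ0 : θ ≠ 0)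
    (hψ0 : ψ 0 = θ) {Φ : ℂ → ℂ} (hΦ : AnalyticAt ℂ Φ 0)
    (hdir : ∃ z : ℂ, z ^ k = 2 * Real.pi * I ∧ (Φ 0 * z ^ M).re ≠ 0)
    (hgerm : ∀ᶠ s in 𝓝[≠] (0 : ℂ),
      (Sum.elim ![(s ^ k)⁻¹, Φ s * (s ^ M)⁻¹] ![ψ s, Complex.exp (Φ s * (s ^ M)⁻¹)] :
        Fin 2 ⊕ Fin 2 → ℂ) ∈ S) :
    UnprojectedDense S := by
  classical
  obtain ⟨z, hz, hzre⟩ := hdir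
  -- `θ = e^τ`; chart WITH TANGENT `z`; witness
  set τ : ℂ := Complex.log θ with hτdef
  have hτ : Complex.exp τ = θ := Complex.exp_log hθ0
  obtain ⟨m, hman, hm0, hmz, hchart⟩ := exists_ramifiedChart_root hψ hθ0 hψ0 τ hk hz
  have h2πI : (2 * Real.pi * I : ℂ) ≠ 0 := by simp [Real.pi_ne_zero, Complex.I_ne_zero]
  have hm' : deriv m 0 ≠ 0 := by
    rw [hmz]
    rintro rfl
    rw [zero_pow (by omega)] at hz
    exact h2πI hz.symm
  obtain ⟨U, r, Pl, m₀, μ, σ, hUan, -, hran, hPldeg, hPlM, hside, hμ0, hμ, -, hGσ, hxU, hexpσ, hnorm,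
      -, hid₁⟩ :=
    exists_ramified_witness_branch hθ0 hτ hk hgerm hman hm0 hm' hchart hΦ M
  -- the leading coefficient `Π_M = Φ(0)·z^M`
  have hmne : ∀ᶠ s in 𝓝[≠] (0 : ℂ), m s ≠ 0 := by
    refine eventually_nhdsWithin_iff.2 ?_
    filter_upwards [hchart] with s hs hs0 using (hs.2.2.2.2 hs0).1
  have hcoeff : Pl.coeff M = Φ 0 * deriv m 0 ^ M :=
    laurentPart_coeff_eq hman hm0 hmne hΦ hM hPldeg hran (hside.mono fun s h => h.2)
  have hre : (Pl.coeff M).re ≠ 0 := by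
    rw [hcoeff, hmz]
    exact hzre
  -- the points
  set q : ℕ → Fin 2 ⊕ Fin 2 → ℂ := fun j =>
    Sum.elim ![(σ j ^ k)⁻¹, Φ (σ j) * (σ j ^ M)⁻¹]
      ![ψ (σ j), Complex.exp (Φ (σ j) * (σ j ^ M)⁻¹)] with hq
  have hqS : ∀ j, q j ∈ S := fun j => hGσ j
  have hqΓ : ∀ j, q j ∈ expGraph ℂ 2 := by
    intro j
    rw [mem_expGraph_iff]
    intro i
    rw [Literature.ModelTheory.ExponentialFields.ExponentialRing.complex_exp_eq]
    fin_cases i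
    · simp [hq, hexpσ j]
    · simp [hq]
  have hid : ∀ j, q j (Sum.inl 1) = Pl.eval ((m₀ + j : ℕ) : ℂ) + r (μ j) := fun j => by
    simp only [hq, Sum.elim_inl, Matrix.cons_val_one, Matrix.cons_val_zero]
    exact hid₁ j
  -- GROWTH (the growth branch of file II, verbatim as in file XV)
  obtain ⟨gR, gI, hgR, -⟩ := exists_re_im_polynomials Pl
  have hgRdeg : 1 ≤ gR.natDegree := le_trans hM (le_natDegree_rePoly hgR hre)
  have hcast : ∀ j, ((m₀ + j : ℕ) : ℂ) = (((m₀ + j : ℕ) : ℝ) : ℂ) := fun j => by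
    rw [Complex.ofReal_natCast]
  have hrlim : Tendsto (fun j => r (μ j)) atTop (𝓝 (r 0)) := hran.continuousAt.tendsto.comp hμ
  have hreq : ∀ j, (q j (Sum.inl 1)).re = gR.eval ((m₀ + j : ℕ) : ℝ) + (r (μ j)).re := by
    intro j
    rw [hid j, Complex.add_re, hcast, hgR]
  obtain ⟨M, hM⟩ : ∃ M : ℝ, ∀ j, ‖r (μ j)‖ ≤ M := by
    obtain ⟨C, hC⟩ := isBounded_iff_forall_norm_le.1 (Metric.isBounded_range_of_tendsto _ hrlim)
    exact ⟨C, fun j => hC _ ⟨j, rfl⟩⟩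
  have hM0 : 0 ≤ M := (norm_nonneg _).trans (hM 0)
  have ha : ∀ j, |(q j (Sum.inl 1)).re - gR.eval ((m₀ + j : ℕ) : ℝ)| ≤ M := by
    intro j
    rw [hreq j, add_sub_cancel_left]
    exact (Complex.abs_re_le_norm _).trans (hM j)
  obtain ⟨D, hD, hLD⟩ := log_two_add_norm_eval_le_log_label Pl (le_refl (0 : ℝ))
  have hLD' : ∀ j, Real.log (2 + ‖q j (Sum.inl 1)‖) ≤
      (D + Real.log (1 + M)) * Real.log (3 + 3 * ((m₀ + j : ℕ) : ℝ)) := by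
    intro j
    have hlab0 : (0 : ℝ) ≤ ((m₀ + j : ℕ) : ℝ) := Nat.cast_nonneg _
    have h1 : Real.log (2 + ‖Pl.eval ((m₀ + j : ℕ) : ℂ)‖) ≤
        D * Real.log (3 + 3 * ((m₀ + j : ℕ) : ℝ)) := by
      refine hLD _ _ hlab0 ?_
      rw [Complex.norm_natCast, zero_add]
      linarith
    have h2 : ‖q j (Sum.inl 1)‖ ≤ ‖Pl.eval ((m₀ + j : ℕ) : ℂ)‖ + M := by
      rw [hid j]
      exact (norm_add_le _ _).trans (by linarith [hM j])
    calc Real.log (2 + ‖q j (Sum.inl 1)‖)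
        ≤ Real.log (2 + ‖Pl.eval ((m₀ + j : ℕ) : ℂ)‖ + M) :=
          Real.log_le_log (by positivity) (by linarith)
      _ ≤ (D + Real.log (1 + M)) * Real.log (3 + 3 * ((m₀ + j : ℕ) : ℝ)) :=
          log_two_add_add_le (norm_nonneg _) hM0 (one_le_log_three_add _ hlab0) h1
  have hD' : 0 < D + Real.log (1 + M) := by
    have := Real.log_nonneg (by linarith : (1 : ℝ) ≤ 1 + M)
    linarith
  have hgr : Tendsto (fun j => |(q j (Sum.inl 1)).re| / Real.log (2 + ‖q j (Sum.inl 1)‖))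
      atTop atTop :=
    tendsto_abs_div_log_of_linear_growth hgRdeg m₀ hD' ha
      (fun j => Real.log_le_log two_pos (by linarith [norm_nonneg (q j (Sum.inl 1))])) hLD'
  exact unprojectedDense_of_growth hS hdim 1 hqS hqΓ hgr

/-! ## Part C. Three directions always contain a good one -/

/-- A purely imaginary number squares to minus its squared modulus. [folklore] -/
theorem sq_eq_neg_norm_sq_of_re_eq_zero {w : ℂ} (h : w.re = 0) :
    w ^ 2 = -(((‖w‖ ^ 2 : ℝ)) : ℂ) := by
  have hw : w = (w.im : ℂ) * I := Complex.ext (by simp [h]) (by simp)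
  have hn : ‖w‖ = |w.im| := by
    rw [hw, norm_mul, Complex.norm_I, mul_one, Complex.norm_real, Real.norm_eq_abs]
    simp
  rw [hn, sq_abs]
  conv_lhs => rw [hw]
  rw [mul_pow, Complex.I_sq]
  push_cast
  ring

/-- **Three directions contain a good one.**  If `k ∤ 2M` and `a ≠ 0`, then `Re(a·z^M) ≠ 0` for
some `k`-th root `z` of `2πi`: with `c` the principal root and `ω = e^{2πi/k}`, the numbers `a c^M`
and `a c^M ω^M` have equal modulus; were both purely imaginary they would be `±` each other, i.e.
`ω^{2M} = 1`, i.e. `k ∣ 2M`. [folklore] -/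
theorem exists_direction_of_not_dvd {k M : ℕ} (hk : 1 ≤ k) (hkM : ¬ k ∣ 2 * M) {a : ℂ}
    (ha : a ≠ 0) : ∃ z : ℂ, z ^ k = 2 * Real.pi * I ∧ (a * z ^ M).re ≠ 0 := by
  have hk0 : k ≠ 0 := by omega
  have hkC : (k : ℂ) ≠ 0 := Nat.cast_ne_zero.2 hk0
  have h2πI : (2 * Real.pi * I : ℂ) ≠ 0 := by simp [Real.pi_ne_zero, Complex.I_ne_zero]
  -- the principal root `c` and the primitive root of unity `ω`
  set c : ℂ := Complex.exp ((1 / (k : ℂ)) * Complex.log (2 * Real.pi * I)) with hc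
  have hck : c ^ k = 2 * Real.pi * I := by
    rw [hc, ← Complex.exp_nat_mul, ← mul_assoc, show ((k : ℂ)) * (1 / (k : ℂ)) = 1 by field_simp,
      one_mul, Complex.exp_log h2πI]
  have hc0 : c ≠ 0 := Complex.exp_ne_zero _
  set ω : ℂ := Complex.exp (2 * Real.pi * I / k) with hω
  have hprim : IsPrimitiveRoot ω k := by
    rw [hω]
    exact Complex.isPrimitiveRoot_exp k hk0
  have hωk : ω ^ k = 1 := hprim.pow_eq_one
  have hωn : ‖ω‖ = 1 := Complex.norm_eq_one_of_pow_eq_one hωk hk0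
  -- either the principal direction `c` is good, or the next one `cω` is
  by_cases h0 : (a * c ^ M).re = 0
  · refine ⟨c * ω, by rw [mul_pow, hck, hωk, mul_one], fun h1 => hkM ?_⟩
    -- equal moduli, both purely imaginary ⟹ equal squares
    have hnorm : ‖a * (c * ω) ^ M‖ = ‖a * c ^ M‖ := by
      rw [mul_pow, ← mul_assoc, norm_mul, norm_pow, hωn, one_pow, mul_one]
    have hsq : (a * (c * ω) ^ M) ^ 2 = (a * c ^ M) ^ 2 := by
      rw [sq_eq_neg_norm_sq_of_re_eq_zero h1, sq_eq_neg_norm_sq_of_re_eq_zero h0, hnorm]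
    -- cancel `(a c^M)²`: `ω^{2M} = 1`, so `k ∣ 2M`
    have hω2M : ω ^ (2 * M) = 1 := by
      have hne : (a * c ^ M) ^ 2 ≠ 0 := pow_ne_zero _ (mul_ne_zero ha (pow_ne_zero _ hc0))
      have h' : (a * c ^ M) ^ 2 * (ω ^ (2 * M)) = (a * c ^ M) ^ 2 * 1 :=
        calc (a * c ^ M) ^ 2 * ω ^ (2 * M) = (a * (c * ω) ^ M) ^ 2 := by ring
          _ = (a * c ^ M) ^ 2 := hsq
          _ = (a * c ^ M) ^ 2 * 1 := (mul_one _).symm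
      exact mul_left_cancel₀ hne h'
    exact (hprim.pow_eq_one_iff_dvd (2 * M)).1 hω2M
  · exact ⟨c, hck, h0⟩

/-- **No direction condition when `k ∤ 2M`.**  `S ⊆ ℂ² × ℂ²` irreducible closed of dimension
`≤ 2` containing a cylinder germ `(s^{-k}, Φ(s)s^{-M}, ψ(s), e^{Φ(s)s^{-M}})` with `ψ(0) ≠ 0`,
`Φ(0) ≠ 0`, `k, M ≥ 1`, `k ∤ 2M` has Zariski-dense exponential points — whatever the direction
`Φ(0)` and in every regime (`M < k`, `M > k`).
[cite: MantovaMasser2023, §1 Further remarks, p. 5 (the question, open in general)] (new) -/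
theorem unprojectedDense_branch_of_not_dvd {S : Set (Fin 2 ⊕ Fin 2 → ℂ)}
    (hS : IsIrreducibleClosed ℂ S) (hdim : zariskiDim ℂ S ≤ (2 : ℕ))
    {k M : ℕ} (hk : 1 ≤ k) (hM : 1 ≤ M) (hkM : ¬ k ∣ 2 * M) {ψ : ℂ → ℂ} (hψ : AnalyticAt ℂ ψ 0)
    {θ : ℂ} (hθ0 : θ ≠ 0) (hψ0 : ψ 0 = θ) {Φ : ℂ → ℂ} (hΦ : AnalyticAt ℂ Φ 0) (hΦ0 : Φ 0 ≠ 0)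
    (hgerm : ∀ᶠ s in 𝓝[≠] (0 : ℂ),
      (Sum.elim ![(s ^ k)⁻¹, Φ s * (s ^ M)⁻¹] ![ψ s, Complex.exp (Φ s * (s ^ M)⁻¹)] :
        Fin 2 ⊕ Fin 2 → ℂ) ∈ S) :
    UnprojectedDense S :=
  unprojectedDense_branch_growth_of_exists_direction hS hdim hk hM hψ hθ0 hψ0 hΦ
    (exists_direction_of_not_dvd hk hkM hΦ0) hgerm

end Summit.Schanuel.Schanuel.Theorems

end
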